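import Summits.QuantumFields.BalabanUV.Beta.FP.NestedDeadRowsOrderTwoTowerClosedG
import Summits.QuantumFields.BalabanUV.Beta.FP.TorusCompositeSliceG
import Summits.QuantumFields.BalabanUV.Beta.FP.TorusCompositeCovarianceSym
import Summits.QuantumFields.BalabanUV.Beta.FP.TorusEffFormCompositeG
import Summits.QuantumFields.BalabanUV.Beta.FP.NestedStepLawTorusCompositeOneShot
import Summits.QuantumFields.BalabanUV.Beta.FP.NestedStepLawTorusCompositeOneShotTopSym
import Summits.QuantumFields.BalabanUV.Beta.FP.RelInvPeriodisedCombRecord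
import Summits.QuantumFields.BalabanUV.Beta.FP.RelInvPeriodisedCombTorusLetters

/-!
# `BalabanUV.Beta.FP.TowerUTopClosedSym` — road «FP» for binder row D1, ROUTE T under RULING R-D1-g52-1 (β1) ∕ R-FP-71 ∕ R-FP-72: **#21's `uTop` SLOT CLOSED AT THE
# (0.4)-SYMMETRISED RECORD FOR EVERY TOP SOURCE, NOTHING DISPLAYED BUT THE PINS** — the first letter of R-FP-72's naming pass (`TowerKernelLawNamed` imports it)

WHY.  The sym tower's door (#21-Sym ∕ #41c-Sym ∕ #41d-Sym ∕ #42a-Sym) displays, for every direction `v`, the coarse chart's Faddeev–Popov 2-jet row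
`uTop : secondVar (τ₂ * Dbar) (τ₂ * Db₁f v) (τ₂ * Db₂f v) = 0`.  leaf-06's G-5 §2 `NestedDeadRowsOrderTwoTowerClosedG.torus_uTop_tower_closedG` proves it for the
NESTED COMPOSITE COLUMN `h = minOp H₀ [Q₁₀; τ₁] · (minOp S₁₁ [Q₂₀; τ₂] · (v, 0), 0)` of any top source `v : κ → ℝ` over ANY step-row family, displaying
`c0 hSL a0 hH₀t hInv hc hEff h2F hσ′`; leaf-06 g34's junction `jW4_uTop_sym` (A-W4, journal l.60481; cert b7cb8a1350ad44e0) read it at the sym instance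
`(QSym Lc, fun _ => ctrOff (d+1) Lc)` with `c0 hSL` inhabited by leaf-02 R-20 `compRowsSym_mul_towerGen_succ` ∕ leaf-06 G-1 §3 `det_nestedSliceSym_mul_towerGen_ne_zero`.
THIS FILE inhabits the remaining six letters BY NAME, so that R-FP-72's pass can drop `uTop` from the displayed rows: `a0 :=` the OWNER's `torus_a0_tower` (the sym
kernel's field block IS the rooted one's, (6) §0 `bhKStepSh_Dsh_inl_inl_eq_bhKStepAt`), `hH₀t :=` leaf-05 `torus_H₀_transpose_comb`, `hInv ∕ hEff :=` leaf-05 L5G §3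
`torus_composite_inv_and_eff_sym` (`c := ∏_{i<n+1} (wVH d Lc (lev i))⁻¹ ≠ 0` by `wVH_pos`), `h2F :=` leaf-05 `torus_isUnit_det_kkt_combRows_comb`, `σ′ := σ_{n+1} ≠ 0` by
`prod_stepScale_mul_card_ne_zero` — exactly the dischargers #41d-Sym already uses for `a0 hH₀t htop` and (6) ∕ #19-Sym for `h1 h2`.

WHAT.  §0 `nestedColumn_linear` — the nested column `v ↦ I · (J · (v, 0), 0)` is linear (feeds the door's six (bi)linearity clauses in `TowerKernelLawNamed`).
§1 **`torus_uTop_towerSym_closed`** — binders: `hlev`, `Lc ∣ M′`, (B)'s slot presentation `pμ′ mμ′ hfμ′ hcoarse′`, the sym pins `hH₀ hQ₁₀ hτ₁ hτ₂ hQ₂₀ hDbar`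
(#42a-Sym VERBATIM at the constant centred root list), the resolvent words `hI hS`, the transport constant `c`, a top source `v`, the column pin `hh` and
leaf-02 R-22 ∕ R-27's images `hDb₁ hDb₂` ⊢ `secondVar (τ₂ * Dbar) (τ₂ * Db₁) (τ₂ * Db₂) = 0`.  [folklore] compositions BY NAME; no `def`, no `def … : Prop`,
nothing cited, 0 sorry, default heartbeats.  Nothing of the dictionary ∕ Bałaban's asserted (the presentation is the row's (β1) ruling, quoted).

HONEST DEPENDENCY (page 1, mandatory): continuum YM on T⁴ ⇐ BetaPertH ∧ nine spine estimates (0/9 proved); BetaPertH ⇐ (D1) ∧ (D4) ∧ CAP+tail;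
G-an2-4 gates asym, D1 and NE2/3/4.  HONEST FRAMING (cell contract, verbatim): «discharging `BetaPertH` makes Bałaban's UV stability UNCONDITIONAL —
a real constructive-QFT result; it is NOT the continuum limit and NOT the Clay problem.»  ABSOLUTE RULE (cell charter, verbatim): «No internally-minted
statement may enter as a cited fact. Every hypothesis is either kernel-proved in this package or a verbatim quotation of a PUBLISHED theorem with page
reference. The manuscript(s) under audit are NOT citable for their own disputed steps — they are the thing under adjudication; programme-internal
(2001/route/tribunal) claims are never citable.»  0 estimates; 0∕4 row-D1 binders (hW, hR, D1Tel, D1Rep); NOT (C1), NOT (L2′), NOT (T-ID) complete, NOT SDF,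
NOT D1, NOT BetaPertH, NOT continuum, NOT Clay.  Road «FP» OWNER, b2b-balaban-beta-d1-p3 gen 34 (v1, R-FP-72), 2026-08-25.  No existing file touched.
-/

noncomputable section

open scoped BigOperators Matrix

namespace Summit.QuantumFields.BalabanUV.Beta.FP.TowerUTopClosedSym

open Matrix Finset
open Literature.Probability.LatticeModels (Torus.proj)
open Literature.MathematicalPhysics.QuantumFieldTheory.Balaban1983to89
open Literature.MathematicalPhysics.QuantumFieldTheory.Balaban1983to89.Beta
open Literature.MathematicalPhysics.QuantumFieldTheory.Balaban1983to89.Beta.Composition (kkt)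
open Literature.MathematicalPhysics.QuantumFieldTheory.Balaban1983to89.Beta.CompositionSingular (effForm minOp)
open B5Prop11Plancherel (fine)
open B6Lemma24Torus (pbox)
open AffineAveraging (Site box toSite unitVec)
open AveragingContoursRooted (ctrOff ctrOff_mem_box)
open OneStepResolventKernel (Fib)
open BalabanStepJetsSucc (wVH)
open Summit.QuantumFields.BalabanUV.Beta.BorderedHessian (bhKStepAt stepScale)
open Summit.QuantumFields.BalabanUV.Beta.SymShiftedSpread (bhKStepSh)
open Summit.QuantumFields.BalabanUV.Beta.DshAn1 (Dsh)
open Summit.QuantumFields.BalabanUV.Beta.D1BFx.LogDetSecondVariation (secondVar)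
open Summit.QuantumFields.BalabanUV.Beta.FP.KernelPeriodisationFib (Idx perF perF_apply perZ_apply)
open Summit.QuantumFields.BalabanUV.Beta.FP.TorusCombRows (Res)
open Summit.QuantumFields.BalabanUV.Beta.FP.TorusGaugeCovariance (tgrad tdelta)
open Summit.QuantumFields.BalabanUV.Beta.FP.TorusCompositeObjects (towerTorus NParam combF bigP towerGen)
open Summit.QuantumFields.BalabanUV.Beta.FP.TorusCompositeObjectsG (QSym compRowsSym nestedSliceSym)
open Summit.QuantumFields.BalabanUV.Beta.GAN24.FineReadoutCauchyFrame (toSite_mem_range)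
open Summit.QuantumFields.BalabanUV.Beta.FP.RelInvPeriodisedEffFormCoarse (wVH_pos)
open Summit.QuantumFields.BalabanUV.Beta.FP.RelInvPeriodisedCombTorusLetters (torus_H₀_transpose_comb)
open Summit.QuantumFields.BalabanUV.Beta.FP.RelInvPeriodisedCombRecord (torus_isUnit_det_kkt_combRows_comb)
open Summit.QuantumFields.BalabanUV.Beta.FP.TorusCompositeSlice (prod_stepScale_mul_card_ne_zero)
open Summit.QuantumFields.BalabanUV.Beta.FP.TorusCompositeSliceG (det_nestedSliceSym_mul_towerGen_ne_zero)
open Summit.QuantumFields.BalabanUV.Beta.FP.TorusCompositeCovarianceSym (compRowsSym_mul_towerGen_succ)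
open Summit.QuantumFields.BalabanUV.Beta.FP.TorusEffFormCompositeG (torus_composite_inv_and_eff_sym)
open Summit.QuantumFields.BalabanUV.Beta.FP.NestedStepLawTorusInstance (dvd_fine)
open Summit.QuantumFields.BalabanUV.Beta.FP.NestedStepLawTorusComposite (dvd_towerTorus_succ)
open Summit.QuantumFields.BalabanUV.Beta.FP.NestedStepLawTorusCompositeOneShot (torus_a0_tower)
open Summit.QuantumFields.BalabanUV.Beta.FP.NestedStepLawTorusCompositeOneShotTopSym (bhKStepSh_Dsh_inl_inl_eq_bhKStepAt)
open Summit.QuantumFields.BalabanUV.Beta.FP.NestedDeadRowsOrderTwoTowerClosedG (torus_uTop_tower_closedG)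

variable {d : ℕ}

/-! ## §0 The nested composite column is linear in the top source -/

/-- [folklore] `v ↦ I · (J · (v, 0), 0)` is linear (two `Matrix.mulVec_add ∕ _smul` through `Sum.elim · 0`). -/
theorem nestedColumn_linear {α β γ δ ε : Type*} [Fintype β] [Fintype γ] [Fintype δ] [Fintype ε]
    (I : Matrix α (β ⊕ γ) ℝ) (J : Matrix β (δ ⊕ ε) ℝ) (r : ℝ) (x y : δ → ℝ) :
    I *ᵥ Sum.elim (J *ᵥ Sum.elim (r • x + y) 0) 0 = r • (I *ᵥ Sum.elim (J *ᵥ Sum.elim x 0) 0) + I *ᵥ Sum.elim (J *ᵥ Sum.elim y 0) 0 := by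
  have h1 : (Sum.elim (r • x + y) (0 : ε → ℝ)) = r • Sum.elim x 0 + Sum.elim y 0 := by
    ext (i | i) <;> simp
  have h2 : (Sum.elim (r • (J *ᵥ Sum.elim x 0) + J *ᵥ Sum.elim y 0) (0 : γ → ℝ)) = r • Sum.elim (J *ᵥ Sum.elim x 0) 0 + Sum.elim (J *ᵥ Sum.elim y 0) 0 := by
    ext (i | i) <;> simp
  rw [h1, Matrix.mulVec_add, Matrix.mulVec_smul, h2, Matrix.mulVec_add, Matrix.mulVec_smul]

/-! ## §1 #21's `uTop` CLOSED at the sym record for every top source: G-5 §2 with `c0 hSL a0 hH₀t hInv hEff h2F` discharged by name -/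

section UTop

variable (M' : Fin (d + 1) → ℕ) [∀ μ, NeZero (M' μ)] (Lc : ℕ) [NeZero Lc] (lev : ℕ → ℕ) (n : ℕ)

set_option synthInstance.maxSize 1024 in
/-- [folklore] **`uTop` OF #21-Sym ∕ #42a-Sym FOR THE NESTED COMPOSITE COLUMN OF ANY TOP SOURCE `v`, NOTHING DISPLAYED BUT THE PINS** (leaf-06 A-W4's `jW4_uTop_sym`
with its six remaining letters inhabited): `c0 :=` leaf-02 R-20, `hSL :=` leaf-06 G-1 §3, `a0 :=` `torus_a0_tower` (the sym kernel's field block IS the rooted one's,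
`bhKStepSh_Dsh_inl_inl_eq_bhKStepAt`), `hH₀t :=` `torus_H₀_transpose_comb`, `hInv ∕ hEff :=` leaf-05 L5G §3 `torus_composite_inv_and_eff_sym` (`c := ∏ (wVH)⁻¹ ≠ 0` by
`wVH_pos`), `h2F :=` `torus_isUnit_det_kkt_combRows_comb`, `σ′ := σ_{n+1} ≠ 0` by `prod_stepScale_mul_card_ne_zero`. -/
theorem torus_uTop_towerSym_closed (hlev : ∀ i, lev i = lev (i + 1) + 1) (hM' : ∀ i, Lc ∣ M' i)
    {κ : Type*} [Fintype κ] [DecidableEq κ] (pμ' : κ → ↥(pbox M')) (mμ' : κ → Fin (d + 1))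
    (hfμ' : Function.Injective (fun a : κ => ((pμ' a, Sum.inr (mμ' a)) : Idx M' (Fib d))))
    (hcoarse' : ∀ (s : ↥(pbox M')) (m : Fin (d + 1)),
      ((s, Sum.inr m) : Idx M' (Fib d)) ∈ Set.range (fun a : κ => ((pμ' a, Sum.inr (mμ' a)) : Idx M' (Fib d))) ↔ Torus.proj Lc (s : Site (d + 1)) = 0)
    {H₀ : Matrix (↥(pbox (towerTorus Lc M' (n + 1))) × Fin (d + 1)) (↥(pbox (towerTorus Lc M' (n + 1))) × Fin (d + 1)) ℝ}
    (hH₀ : H₀ = (perF (towerTorus Lc M' (n + 1)) (bhKStepSh d Lc (Dsh Lc) (lev (n + 1)))).submatrix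
        (fun b : ↥(pbox (towerTorus Lc M' (n + 1))) × Fin (d + 1) => ((b.1, Sum.inl b.2) : Idx (towerTorus Lc M' (n + 1)) (Fib d)))
        (fun b : ↥(pbox (towerTorus Lc M' (n + 1))) × Fin (d + 1) => ((b.1, Sum.inl b.2) : Idx (towerTorus Lc M' (n + 1)) (Fib d))))
    {Q₁₀ : Matrix (↥(pbox M') × Fin (d + 1)) (↥(pbox (towerTorus Lc M' (n + 1))) × Fin (d + 1)) ℝ}
    (hQ₁₀ : Q₁₀ = compRowsSym Lc M' lev (fun _ : ℕ => ctrOff (d + 1) Lc) (n + 1))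
    {τ₁ : Matrix (NParam Lc (fine Lc M') (fun _ : ℕ => ctrOff (d + 1) Lc) n) (↥(pbox (towerTorus Lc M' (n + 1))) × Fin (d + 1)) ℝ}
    (hτ₁ : τ₁ = bigP Lc (fine Lc M') (fun _ : ℕ => ctrOff (d + 1) Lc)
      (fun _ => toSite_mem_range (ctrOff_mem_box (d := d + 1) (Nat.one_le_iff_ne_zero.mpr (NeZero.ne Lc)))) n)
    {τ₂ : Matrix (Res (toSite (ctrOff (d + 1) Lc)) Lc M') (↥(pbox M') × Fin (d + 1)) ℝ} (hτ₂ : τ₂ = combF Lc M' (ctrOff (d + 1) Lc))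
    {Q₂₀ : Matrix κ (↥(pbox M') × Fin (d + 1)) ℝ}
    (hQ₂₀ : Q₂₀ = (perF M' (bhKStepSh d Lc (Dsh Lc) (lev 0))).submatrix (fun a : κ => ((pμ' a, Sum.inr (mμ' a)) : Idx M' (Fib d)))
        (fun b : ↥(pbox M') × Fin (d + 1) => ((b.1, Sum.inl b.2) : Idx M' (Fib d))))
    {Dbar : Matrix (↥(pbox M') × Fin (d + 1)) (Res (toSite (ctrOff (d + 1) Lc)) Lc M') ℝ}
    (hDbar : Dbar = (∏ i ∈ range (n + 1), (stepScale d Lc (lev (i + 1)) * ((box (d + 1) Lc).card : ℝ))) •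
        (tgrad M').submatrix (fun a : ↥(pbox M') × Fin (d + 1) => ((a.1, Sum.inl a.2) : Idx M' (Fib d))) (fun t : Res (toSite (ctrOff (d + 1) Lc)) Lc M' => (t.1 : ↥(pbox M'))))
    {I : Matrix (↥(pbox (towerTorus Lc M' (n + 1))) × Fin (d + 1)) ((↥(pbox M') × Fin (d + 1)) ⊕ (NParam Lc (fine Lc M') (fun _ : ℕ => ctrOff (d + 1) Lc) n)) ℝ}
    (hI : minOp H₀ (fromRows Q₁₀ τ₁) = I)
    {S : Matrix ((↥(pbox M') × Fin (d + 1)) ⊕ (NParam Lc (fine Lc M') (fun _ : ℕ => ctrOff (d + 1) Lc) n)) ((↥(pbox M') × Fin (d + 1)) ⊕ (NParam Lc (fine Lc M') (fun _ : ℕ => ctrOff (d + 1) Lc) n)) ℝ}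
    (hS : effForm H₀ (fromRows Q₁₀ τ₁) = S)
    (c : ℝ) (v : κ → ℝ)
    {h : ↥(pbox (towerTorus Lc M' (n + 1))) × Fin (d + 1) → ℝ} (hh : h = I *ᵥ Sum.elim (minOp S.toBlocks₁₁ (fromRows Q₂₀ τ₂) *ᵥ Sum.elim v 0) 0)
    {Db₁ : Matrix (↥(pbox M') × Fin (d + 1)) (Res (toSite (ctrOff (d + 1) Lc)) Lc M') ℝ}
    (hDb₁ : Db₁ = Matrix.of fun (a : ↥(pbox M') × Fin (d + 1)) (t : Res (toSite (ctrOff (d + 1) Lc)) Lc M') =>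
        -(c * (compRowsSym Lc M' lev (fun _ : ℕ => ctrOff (d + 1) Lc) (n + 1) *ᵥ h) a * tdelta M' ((a.1 : Site (d + 1)) + unitVec a.2) t.1))
    {Db₂ : Matrix (↥(pbox M') × Fin (d + 1)) (Res (toSite (ctrOff (d + 1) Lc)) Lc M') ℝ}
    (hDb₂ : Db₂ = Matrix.of fun (a : ↥(pbox M') × Fin (d + 1)) (t : Res (toSite (ctrOff (d + 1) Lc)) Lc M') =>
        (c ^ 2 * (∏ i ∈ range (n + 1), (stepScale d Lc (lev (i + 1)) * ((box (d + 1) Lc).card : ℝ)))⁻¹)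
          * ((compRowsSym Lc M' lev (fun _ : ℕ => ctrOff (d + 1) Lc) (n + 1) *ᵥ h) a) ^ 2 * tdelta M' ((a.1 : Site (d + 1)) + unitVec a.2) t.1) :
    secondVar (τ₂ * Dbar) (τ₂ * Db₁) (τ₂ * Db₂) = 0 := by
  have hL0 : 0 < Lc := Nat.pos_of_ne_zero (NeZero.ne Lc)
  have hc : ctrOff (d + 1) Lc ∈ box (d + 1) Lc := ctrOff_mem_box (d := d + 1) (Nat.one_le_iff_ne_zero.mpr (NeZero.ne Lc))
  have hIE := torus_composite_inv_and_eff_sym Lc n M' lev hlev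
  have hH₀' : H₀ = (perF (towerTorus Lc M' (n + 1)) (bhKStepAt d (toSite (ctrOff (d + 1) Lc)) Lc (lev (n + 1)))).submatrix
      (fun b : ↥(pbox (towerTorus Lc M' (n + 1))) × Fin (d + 1) => ((b.1, Sum.inl b.2) : Idx (towerTorus Lc M' (n + 1)) (Fib d)))
      (fun b : ↥(pbox (towerTorus Lc M' (n + 1))) × Fin (d + 1) => ((b.1, Sum.inl b.2) : Idx (towerTorus Lc M' (n + 1)) (Fib d))) := by
    rw [hH₀]; ext p q
    simp only [Matrix.submatrix_apply, perF_apply, perZ_apply]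
    exact tsum_congr fun m => bhKStepSh_Dsh_inl_inl_eq_bhKStepAt Lc (toSite (ctrOff (d + 1) Lc)) (lev (n + 1)) _ _ _ _
  subst hI hS
  exact torus_uTop_tower_closedG M' Lc lev (fun _ : ℕ => ctrOff (d + 1) Lc) n (QSym Lc) (fun _ => hc) hM' H₀ hQ₁₀ hτ₁ hτ₂ Q₂₀
    ((∏ i ∈ range (n + 1), (stepScale d Lc (lev (i + 1)) * ((box (d + 1) Lc).card : ℝ))) •
      (tgrad M').submatrix (fun a : ↥(pbox M') × Fin (d + 1) => ((a.1, Sum.inl a.2) : Idx M' (Fib d))) (fun t : Res (toSite (ctrOff (d + 1) Lc)) Lc M' => (t.1 : ↥(pbox M'))))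
    (by rw [hQ₁₀]; exact compRowsSym_mul_towerGen_succ Lc hc n M' lev)
    (det_nestedSliceSym_mul_towerGen_ne_zero Lc (compRowsSym_mul_towerGen_succ Lc hc) n (fine Lc M') (fun k => lev (k + 1)) (dvd_fine M'))
    (torus_a0_tower Lc M' lev (fun _ : ℕ => ctrOff (d + 1) Lc) n (fun _ => hc) hH₀' rfl)
    (by rw [hH₀]; exact torus_H₀_transpose_comb (towerTorus Lc M' (n + 1)) (dvd_towerTorus_succ (Lc := Lc) M' n) (lev (n + 1)))
    (by rw [hH₀, hQ₁₀]; exact hIE.1)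
    (c := ∏ i ∈ range (n + 1), (wVH d Lc (lev i))⁻¹) (Finset.prod_ne_zero_iff.mpr fun i _ => inv_ne_zero (wVH_pos hL0 (lev i)).ne')
    (by rw [hH₀, hQ₁₀]; exact hIE.2)
    (by rw [hQ₂₀, hτ₂]; exact torus_isUnit_det_kkt_combRows_comb M' hM' (lev 0) _ hfμ' (fun a => ⟨mμ' a, rfl⟩) hcoarse')
    (prod_stepScale_mul_card_ne_zero (d := d) Lc lev (n + 1)) hDbar v rfl hh c hDb₁ hDb₂

end UTop

end Summit.QuantumFields.BalabanUV.Beta.FP.TowerUTopClosedSym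

end
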